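import Literature.ModelTheory.FiniteModelTheory.ESO
import Literature.Computability.Complexity.CookLevinTableau
import Literature.Computability.Complexity.TM2PassThrough
import Mathlib.Algebra.BigOperators.Fin
import HarnessLib

/-!
# The layout of the code of a finite relational structure

Topic `Literature/ModelTheory/FiniteModelTheory`; shared by both directions of Fagin's theorem
(`ESOInputBits.lean`: the input formula `ι` of the `∃SO` sentence; `ESOVerifier.lean`: the
polynomial-time evaluator of the first-order part). The tree codes the finite `ar`-structure
`⟨n, R⟩` as `encodingSNPInstance ar ⟨n, R⟩ = boolPair (encodeNat n) (table bits)` (`SNP.lean`):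
the binary numeral of `n` with doubled bits, the separator `01`, then the `Σₛ n^{arₛ}` table bits
laid out by `relTablesEquiv` (Mathlib `finSigmaFinEquiv` over the symbols, `finFunctionFinEquiv`
— little-endian digits — inside each table). This file names the code (`codeOf R`) and proves
where everything sits:

* `getElem?_codeOf_header` (position `J < 2|bin n|` holds binary digit `J / 2` of `n`),
  `getElem?_codeOf_sep0/sep1`, `getElem?_codeOf_table` (position `2|bin n| + 2 + m` holds table
  bit `m`), `length_codeOf`, `getElem?_codeOf_none`;
* `tableOffset ar n s = Σ_{i<s} n^{arᵢ}` and the LAYOUT LEMMA `relTablesEquiv_apply_table`: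
  table bit `tableOffset s + Σᵢ wᵢ nⁱ` is `R s w`; `exists_table_decomp`.

## References

* L. Libkin, *Elements of Finite Model Theory*, Springer 2004, §6.1, (6.1)–(6.2), p. 87
  (`enc(𝔄) = 0ⁿ1 · enc(R₁) ⋯ enc(R_p)`, "1 in position `u · n + v` iff `(u, v) ∈ E`"); printed
  page numbers (PDF = printed + 18 in the held copy).
* N. Immerman, *Descriptive Complexity*, Springer 1999, §2.1 (`bin(𝔄)`).
-/

namespace Literature.ModelTheory.FiniteModelTheory

open _root_.Computability Literature.Computability.Complexity Literature.Computability.Cryptography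

/-! ### The positions of the code of a finite structure -/

section Code

variable {ar : List ℕ} {n : ℕ}

/-- The code of the finite `ar`-structure `⟨n, R⟩` (`encodingSNPInstance`). [folklore] -/
def codeOf (R : RelTables ar n) : List Bool := (encodingSNPInstance ar).encode ⟨n, R⟩

/-- Unfolding the code: `boolPair (encodeNat n) (List.ofFn (relTablesEquiv ar n R))`. [folklore] -/
theorem codeOf_eq (R : RelTables ar n) :
    codeOf R = boolPair (encodeNat n) (List.ofFn (relTablesEquiv ar n R)) := rfl

/-- The bits of a word are the binary digits of its value. [folklore] -/
theorem getElem?_eq_testBit (w : List Bool) {i : ℕ} (hi : i < w.length) :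
    w[i]? = some ((bitsToNat w).testBit i) := by
  induction w generalizing i with
  | nil => simp at hi
  | cons b w ih =>
    cases i with
    | zero =>
      simp only [List.getElem?_cons_zero, bitsToNat_cons, Nat.testBit_zero, Option.some.injEq]
      cases b <;> simp [Nat.add_mod]
    | succ i =>
      simp only [List.length_cons] at hi
      rw [List.getElem?_cons_succ, ih (by omega), bitsToNat_cons, Nat.testBit_succ]
      congr 2
      cases b <;> simp [Nat.add_mul_div_left]

/-- The bits of `encodeNat n` are the binary digits of `n`. [folklore] -/
theorem getElem?_encodeNat {i : ℕ} (hi : i < Nat.size n) :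
    (encodeNat n)[i]? = some (n.testBit i) := by
  rw [getElem?_eq_testBit _ (by rwa [TM2Pass.length_encodeNat_eq_size]), bitsToNat_encodeNat]

/-- HEADER positions of the code: position `J < 2|bin n|` holds binary digit `J / 2` of `n`.
[Libkin 2004, p. 172; Immerman 1999, §2.1] [folklore] -/
theorem getElem?_codeOf_header (R : RelTables ar n) {J : ℕ} (hJ : J < 2 * Nat.size n) :
    (codeOf R)[J]? = some (n.testBit (J / 2)) := by
  rw [codeOf_eq]
  rcases Nat.even_or_odd J with ⟨i, rfl⟩ | ⟨i, rfl⟩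
  · have h := (Tableau.getElem?_boolPair_bit (List.ofFn (relTablesEquiv ar n R))
      (getElem?_encodeNat (n := n) (i := i) (by omega))).1
    rw [show 2 * i + 1 - 1 = i + i by omega] at h
    rw [h, show (i + i) / 2 = i by omega]
  · have h := (Tableau.getElem?_boolPair_bit (List.ofFn (relTablesEquiv ar n R))
      (getElem?_encodeNat (n := n) (i := i) (by omega))).2
    rw [show 2 * i + 2 - 1 = 2 * i + 1 by omega] at h
    rw [h, show (2 * i + 1) / 2 = i by omega]

/-- The first SEPARATOR position `2|bin n|` holds `false`. [folklore] -/
theorem getElem?_codeOf_sep0 (R : RelTables ar n) : (codeOf R)[2 * Nat.size n]? = some false := by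
  rw [codeOf_eq, ← TM2Pass.length_encodeNat_eq_size, ← Nat.add_zero (2 * _), Tableau.getElem?_boolPair_add]
  rfl

/-- The second separator position `2|bin n| + 1` holds `true`. [folklore] -/
theorem getElem?_codeOf_sep1 (R : RelTables ar n) :
    (codeOf R)[2 * Nat.size n + 1]? = some true := by
  rw [codeOf_eq, ← TM2Pass.length_encodeNat_eq_size, Tableau.getElem?_boolPair_add]
  rfl

/-- TABLE positions of the code: position `2|bin n| + 2 + m`, `m < tableBits ar n`, holds table
bit `m`. [Libkin 2004, (6.1)] [folklore] -/
theorem getElem?_codeOf_table (R : RelTables ar n) {m : ℕ} (hm : m < tableBits ar n) :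
    (codeOf R)[2 * Nat.size n + 2 + m]? = some (relTablesEquiv ar n R ⟨m, hm⟩) := by
  rw [codeOf_eq, ← TM2Pass.length_encodeNat_eq_size, Nat.add_assoc, Tableau.getElem?_boolPair_add,
    Nat.add_comm 2 m]
  change (false :: true :: List.ofFn (relTablesEquiv ar n R))[m + 1 + 1]? = _
  rw [List.getElem?_cons_succ, List.getElem?_cons_succ, List.getElem?_ofFn]
  simp [hm]

/-- The length of the code: `2|bin n| + 2 + tableBits ar n`. [Libkin 2004, (6.2)] [folklore] -/
theorem length_codeOf (R : RelTables ar n) :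
    (codeOf R).length = 2 * Nat.size n + 2 + tableBits ar n := by
  rw [codeOf, length_encodingSNPInstance_encode, TM2Pass.length_encodeNat_eq_size]

/-- Beyond the length there are no positions. [Libkin 2004, p. 171 (`ξ`)] [folklore] -/
theorem getElem?_codeOf_none (R : RelTables ar n) {J : ℕ}
    (hJ : 2 * Nat.size n + 2 + tableBits ar n ≤ J) : (codeOf R)[J]? = none :=
  List.getElem?_eq_none (by rw [length_codeOf]; exact hJ)

/-- The OFFSET of table `s` among the table bits: `Σ_{i<s} n^{arᵢ}` (Mathlib's
`finSigmaFinEquiv` layout). [Libkin 2004, (6.1)] [folklore] -/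
def tableOffset (ar : List ℕ) (n : ℕ) (s : Fin ar.length) : ℕ :=
  ∑ i : Fin s, n ^ ar.get (Fin.castLE s.2.le i)

/-- Unfolding `relTablesEquiv`: bit `x` is `R s (digits of j)` for `⟨s, j⟩ = finSigmaFinEquiv⁻¹ x`.
[folklore] -/
theorem relTablesEquiv_apply (R : RelTables ar n) (x : Fin (tableBits ar n)) :
    relTablesEquiv ar n R x =
      R ((finSigmaFinEquiv.symm x : Σ i : Fin ar.length, Fin (n ^ ar.get i))).1
        (finFunctionFinEquiv.symm
          ((finSigmaFinEquiv.symm x : Σ i : Fin ar.length, Fin (n ^ ar.get i))).2) :=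
  rfl

/-- **Layout of the table bits**: table bit `tableOffset s + Σᵢ wᵢ nⁱ` is `R s w`.
[Libkin 2004, (6.1) ("1 in position `u · n + v` iff `(u, v) ∈ E`")] [folklore] -/
theorem relTablesEquiv_apply_table (R : RelTables ar n) (s : Fin ar.length)
    (w : Fin (ar.get s) → Fin n) :
    relTablesEquiv ar n R (finSigmaFinEquiv ⟨s, finFunctionFinEquiv w⟩) = R s w := by
  rw [relTablesEquiv_apply, Equiv.symm_apply_apply]
  change R s (finFunctionFinEquiv.symm (finFunctionFinEquiv w)) = R s w
  rw [Equiv.symm_apply_apply]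

/-- The index of that table bit is `tableOffset s + Σᵢ wᵢ nⁱ`. [folklore] -/
theorem val_finSigmaFinEquiv_table (s : Fin ar.length) (w : Fin (ar.get s) → Fin n) :
    ((finSigmaFinEquiv ⟨s, finFunctionFinEquiv w⟩ : Fin (tableBits ar n)) : ℕ) =
      tableOffset ar n s + (finFunctionFinEquiv w : ℕ) := by
  rw [finSigmaFinEquiv_apply]
  rfl

/-- Every table bit index decomposes as `tableOffset s + Σᵢ wᵢ nⁱ`. [folklore] -/
theorem exists_table_decomp {m : ℕ} (hm : m < tableBits ar n) :
    ∃ (s : Fin ar.length) (w : Fin (ar.get s) → Fin n),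
      finSigmaFinEquiv ⟨s, finFunctionFinEquiv w⟩ = (⟨m, hm⟩ : Fin (tableBits ar n)) := by
  obtain ⟨⟨s, j⟩, h⟩ := finSigmaFinEquiv.surjective (⟨m, hm⟩ : Fin (tableBits ar n))
  refine ⟨s, finFunctionFinEquiv.symm j, ?_⟩
  rw [Equiv.apply_symm_apply]
  exact h

end Code

end Literature.ModelTheory.FiniteModelTheory
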